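import Mathlib
import Summits.MatrixMultiplication.MatrixMultiplication.Theorems.FidelityWitnessesFidelityGapTwoSixExplicitFrameA
import Summits.MatrixMultiplication.MatrixMultiplication.Theorems.FidelityWitnessesFidelityGapTwoSixExplicitRows
import Literature.Computability.AlgebraicComplexity.TensorApolarityForms

/-!
# `FidelityGapTwoSixExplicit` — the transported plane `Y_F`, row bounds, the missing plane

Part of the proof of `FidelityWitnesses.FidelityGapTwoSixExplicit` (stmt-MatrixMultiplication-14041); see
`FidelityWitnessesFidelityGapTwoSixExplicitDefs.lean` for the line of argument.  Here: `Y_F = kerProj (Z_F)`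
has the dimension of `Z_F` (`≥ 6`); a slot vector `ℓ ⊗ e_a` of a form `ℓ ⊥ F` is orthogonal to `F ⊗ A*`,
hence almost orthogonal to `Y_F`, and on `kerSpan` slot tests are row tests, so every row of either
`U`-component of `ℓ` has projection onto `Y_F` of square norm `≤ (2θ/(1−2θ))‖ℓ‖²` (the frame theorem
`exists_plane_of_frame`); finally `dim perpTo F = 16 − dim F`, `dim annT = 12`, so the missing plane
`annT ⊓ perpTo F` of a `10`-plane has dimension `≥ 2`.
-/

noncomputable section

namespace Summit.MatrixMultiplication.MatrixMultiplication.Theorems.GapTwoSixExplicit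

-- single-conjunct summit: the `Summit.<S>.<P>` prefix repeats `MatrixMultiplication` by design (D-0017)
set_option linter.dupNamespace false

open scoped BigOperators ComplexConjugate InnerProductSpace
open Literature.Computability.AlgebraicComplexity Module

/-! ## Transport of `Z_F` into the kernel: the plane `Y_F = kerProj (Z_F)` -/

/-- `kerProj` is injective on `Z_F` when the slice defect is `< 1/2`. [folklore] -/
theorem kerProj_injOn_zSub {F : Submodule ℂ (P2 × P2 → ℂ)} {θ : ℝ}
    (hθ : ∀ f ∈ F, (∑ c : P2, ‖∑ p : P2 × P2, f p * T2 c p.1 p.2‖ ^ 2) ≤ θ * ∑ p, ‖f p‖ ^ 2)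
    (hθ2 : 2 * θ < 1) {z : V64} (hz : z ∈ zSub F) (h0 : kerProj z = 0) : z = 0 := by
  have h1 := norm_sq_sub_kerProj_le_of_mem_zSub hθ hz
  rw [h0, sub_zero] at h1
  have h2 : ‖z‖ ^ 2 = 0 := by nlinarith [sq_nonneg ‖z‖]
  exact norm_eq_zero.1 (pow_eq_zero_iff two_ne_zero |>.1 h2)

/-- **The transported plane `Y_F := kerProj (Z_F)` has the dimension of `Z_F`.** [folklore] -/
theorem finrank_map_kerProj_zSub {F : Submodule ℂ (P2 × P2 → ℂ)} {θ : ℝ}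
    (hθ : ∀ f ∈ F, (∑ c : P2, ‖∑ p : P2 × P2, f p * T2 c p.1 p.2‖ ^ 2) ≤ θ * ∑ p, ‖f p‖ ^ 2)
    (hθ2 : 2 * θ < 1) :
    finrank ℂ ((zSub F).map kerProj) = finrank ℂ (zSub F) := by
  have hinj : Function.Injective (kerProj.domRestrict (zSub F)) := by
    intro z z' hzz'
    apply Subtype.ext
    have h : kerProj ((z : V64) - z') = 0 := by
      rw [map_sub]
      exact sub_eq_zero.2 (by simpa using hzz')
    have hmem : (z : V64) - z' ∈ zSub F := Submodule.sub_mem _ z.2 z'.2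
    exact sub_eq_zero.1 (kerProj_injOn_zSub hθ hθ2 hmem h)
  rw [← LinearMap.range_domRestrict, LinearMap.finrank_range_of_inj hinj]

/-- `Y_F ≤ kerSpan`. [folklore] -/
theorem map_kerProj_le_kerSpan (Z : Submodule ℂ V64) : Z.map kerProj ≤ kerSpan := by
  rintro y ⟨z, -, rfl⟩
  exact kerProj_mem z

/-! ## Testing `Y_F` against the missing plane `annT ⊓ perpTo F` -/

/-- A vector that is almost orthogonal to a subspace has a small projection onto it (squared form):
`(∀ y ∈ Y, |⟪x, y⟫|² ≤ D ‖y‖²) → ‖P_Y x‖² ≤ D`. [folklore] -/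
theorem norm_sq_starProjection_le_of_inner_sq_le {Y : Submodule ℂ V64} {x : V64} {D : ℝ} (hD : 0 ≤ D)
    (h : ∀ y ∈ Y, ‖⟪x, y⟫_ℂ‖ ^ 2 ≤ D * ‖y‖ ^ 2) : ‖Y.starProjection x‖ ^ 2 ≤ D := by
  set p := Y.starProjection x with hp
  have hmem : p ∈ Y := Y.starProjection_apply_mem x
  have h1 : ⟪x, p⟫_ℂ = ⟪p, p⟫_ℂ := by
    conv_lhs => rw [show p = Y.starProjection p from
      (Submodule.starProjection_eq_self_iff.2 hmem).symm]
    rw [← Submodule.inner_starProjection_left_eq_right, ← hp]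
  have h4 : ‖p‖ ^ 2 ≤ ‖⟪p, p⟫_ℂ‖ := by
    have h5 := inner_self_eq_norm_sq (𝕜 := ℂ) p
    simp only [RCLike.re_to_complex] at h5
    rw [← h5]
    exact Complex.re_le_norm _
  have h2 : (‖p‖ ^ 2) ^ 2 ≤ D * ‖p‖ ^ 2 := by
    calc (‖p‖ ^ 2) ^ 2 ≤ ‖⟪p, p⟫_ℂ‖ ^ 2 := pow_le_pow_left₀ (sq_nonneg _) h4 2
      _ = ‖⟪x, p⟫_ℂ‖ ^ 2 := by rw [h1]
      _ ≤ D * ‖p‖ ^ 2 := h p hmem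
  by_cases hp0 : ‖p‖ ^ 2 = 0
  · rw [hp0]; exact hD
  · have hpos : 0 < ‖p‖ ^ 2 := lt_of_le_of_ne (sq_nonneg _) (Ne.symm hp0)
    nlinarith

/-- Slot vectors have the norm of the bilinear form: `‖ℓ ⊗ e_a‖ = ‖ℓ‖`. [folklore] -/
theorem norm_sq_slotVec (ℓ : V16) (a : P2) : ‖slotVec ℓ a‖ ^ 2 = ‖ℓ‖ ^ 2 := by
  rw [norm_sq_V64, EuclideanSpace.norm_sq_eq]
  have h : (∑ q : (P2 × P2) × P2, ‖slotVec ℓ a q‖ ^ 2) = ∑ a' : P2, ∑ p : P2 × P2, ‖slotVec ℓ a (p, a')‖ ^ 2 := by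
    rw [Fintype.sum_prod_type_right]
  rw [h, Finset.sum_eq_single a]
  · refine Finset.sum_congr rfl fun p _ => ?_
    simp [slotVec]
  · intro a' _ ha'
    refine Finset.sum_eq_zero fun p _ => ?_
    simp [slotVec, ha']
  · intro h; exact absurd (Finset.mem_univ _) h

/-- A slot vector of a form orthogonal to `F` is orthogonal to `F ⊗ A*`. [folklore] -/
theorem inner_slotVec_eq_zero_of_mem {F : Submodule ℂ (P2 × P2 → ℂ)} {ℓ : V16}
    (hℓ : ℓ ∈ perpTo F) (a : P2) {z : V64} (hz : z ∈ tensorSub F) : ⟪slotVec ℓ a, z⟫_ℂ = 0 := by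
  rw [inner_slotVec]
  exact hℓ _ (hz a)

/-- **The missing plane is almost orthogonal to `Y_F`.**  For `ℓ ∈ perpTo F` and `z ∈ Z_F`:
`|⟪ℓ ⊗ e_a, kerProj z⟫|² ≤ (2θ/(1−2θ)) ‖ℓ‖² ‖kerProj z‖²`. [folklore] -/
theorem norm_inner_slotVec_kerProj_le {F : Submodule ℂ (P2 × P2 → ℂ)} {θ : ℝ}
    (hθ : ∀ f ∈ F, (∑ c : P2, ‖∑ p : P2 × P2, f p * T2 c p.1 p.2‖ ^ 2) ≤ θ * ∑ p, ‖f p‖ ^ 2)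
    (hθ0 : 0 ≤ θ) (hθ2 : 2 * θ < 1) {ℓ : V16} (hℓ : ℓ ∈ perpTo F) (a : P2) {z : V64} (hz : z ∈ zSub F) :
    ‖⟪slotVec ℓ a, kerProj z⟫_ℂ‖ ^ 2 ≤ (2 * θ / (1 - 2 * θ)) * ‖ℓ‖ ^ 2 * ‖kerProj z‖ ^ 2 := by
  have h0 : ⟪slotVec ℓ a, z⟫_ℂ = 0 := inner_slotVec_eq_zero_of_mem hℓ a (zSub_le F hz)
  have h1 : ⟪slotVec ℓ a, kerProj z⟫_ℂ = -⟪slotVec ℓ a, z - kerProj z⟫_ℂ := by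
    rw [inner_sub_right, h0, zero_sub, neg_neg]
  have h2 : ‖⟪slotVec ℓ a, kerProj z⟫_ℂ‖ ^ 2 ≤ ‖ℓ‖ ^ 2 * ‖z - kerProj z‖ ^ 2 := by
    rw [h1, norm_neg, ← norm_sq_slotVec ℓ a, ← mul_pow]
    exact pow_le_pow_left₀ (norm_nonneg _) (norm_inner_le_norm _ _) 2
  have h3 := norm_sq_sub_kerProj_le_of_mem_zSub hθ hz
  have h4 : ‖z‖ ^ 2 = ‖kerProj z‖ ^ 2 + ‖z - kerProj z‖ ^ 2 := by
    have := norm_sq_sub_kerProj z; linarith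
  have h5 : (1 - 2 * θ) * ‖z‖ ^ 2 ≤ ‖kerProj z‖ ^ 2 := by nlinarith
  have hden : 0 < 1 - 2 * θ := by linarith
  have h6 : ‖⟪slotVec ℓ a, kerProj z⟫_ℂ‖ ^ 2 ≤ ‖ℓ‖ ^ 2 * (2 * θ * ‖z‖ ^ 2) :=
    h2.trans (mul_le_mul_of_nonneg_left h3 (sq_nonneg _))
  have h7 : ‖ℓ‖ ^ 2 * (2 * θ * ‖z‖ ^ 2) ≤ (2 * θ / (1 - 2 * θ)) * ‖ℓ‖ ^ 2 * ‖kerProj z‖ ^ 2 := by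
    rw [div_mul_eq_mul_div, div_mul_eq_mul_div, le_div_iff₀ hden]
    have : 0 ≤ ‖ℓ‖ ^ 2 * (2 * θ) := by positivity
    nlinarith
  exact h6.trans h7

/-- Projection bound for a vector whose tests against `kerSpan` agree in modulus with those of a
slot vector `ℓ ⊗ e_a`, `ℓ ∈ perpTo F`. [folklore] -/
theorem norm_sq_starProjection_le_of_slot {F : Submodule ℂ (P2 × P2 → ℂ)} {θ : ℝ}
    (hθ : ∀ f ∈ F, (∑ c : P2, ‖∑ p : P2 × P2, f p * T2 c p.1 p.2‖ ^ 2) ≤ θ * ∑ p, ‖f p‖ ^ 2)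
    (hθ0 : 0 ≤ θ) (hθ2 : 2 * θ < 1) {ℓ : V16} (hℓ : ℓ ∈ perpTo F) (a : P2) (x : V64)
    (hx : ∀ y ∈ kerSpan, ‖⟪x, y⟫_ℂ‖ = ‖⟪slotVec ℓ a, y⟫_ℂ‖) :
    ‖((zSub F).map kerProj).starProjection x‖ ^ 2 ≤ (2 * θ / (1 - 2 * θ)) * ‖ℓ‖ ^ 2 := by
  have hD : 0 ≤ (2 * θ / (1 - 2 * θ)) * ‖ℓ‖ ^ 2 :=
    mul_nonneg (div_nonneg (by linarith) (by linarith)) (sq_nonneg _)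
  refine norm_sq_starProjection_le_of_inner_sq_le hD ?_
  rintro y ⟨z, hz, rfl⟩
  rw [hx _ (kerProj_mem z)]
  exact norm_inner_slotVec_kerProj_le hθ hθ0 hθ2 hℓ a hz

/-- **Row bounds.**  For `ℓ ∈ perpTo F` and `Y_F = kerProj (Z_F)`, every row of either
`U`-component of `ℓ` has small projection onto `Y_F`:
`‖P_{Y_F} (rowVec (hComp i ℓ) v)‖² ≤ (2θ/(1−2θ)) ‖ℓ‖²`. [folklore] -/
theorem norm_sq_starProjection_rowVec_le {F : Submodule ℂ (P2 × P2 → ℂ)} {θ : ℝ}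
    (hθ : ∀ f ∈ F, (∑ c : P2, ‖∑ p : P2 × P2, f p * T2 c p.1 p.2‖ ^ 2) ≤ θ * ∑ p, ‖f p‖ ^ 2)
    (hθ0 : 0 ≤ θ) (hθ2 : 2 * θ < 1) {ℓ : V16} (hℓ : ℓ ∈ perpTo F) (i v : Fin 2) :
    ‖((zSub F).map kerProj).starProjection (rowVec (hComp i ℓ) v)‖ ^ 2
      ≤ (2 * θ / (1 - 2 * θ)) * ‖ℓ‖ ^ 2 := by
  revert i
  rw [Fin.forall_fin_two]
  constructor
  · refine norm_sq_starProjection_le_of_slot hθ hθ0 hθ2 hℓ (1, v) _ ?_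
    intro y hy
    rw [inner_slotVec_one hy ℓ v]
  · refine norm_sq_starProjection_le_of_slot hθ hθ0 hθ2 hℓ (0, v) _ ?_
    intro y hy
    rw [inner_slotVec_zero hy ℓ v, norm_neg]

/-! ## The frame theorem and the dimension of the missing plane -/

/-- **The frame theorem (input of Lemma A).**  Let `F` be a `10`-plane of bilinear forms with
`dim F·A* ≤ 34` whose elements have slice defect `≤ θ` against `T = ⟨2,2,2⟩`, `0 ≤ θ < 1/2`.
Then there is a subspace `Y ≤ kerSpan` of dimension `≥ 6` onto which all rows of all
`ℓ ∈ perpTo F` project with square norm `≤ (2θ/(1−2θ))‖ℓ‖²`. [folklore] -/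
theorem exists_plane_of_frame {F : Submodule ℂ (P2 × P2 → ℂ)} {θ : ℝ}
    (hF10 : finrank ℂ F = 10) (hA : finrank ℂ (TensorApolarity.prodA F) ≤ 34)
    (hθ : ∀ f ∈ F, (∑ c : P2, ‖∑ p : P2 × P2, f p * T2 c p.1 p.2‖ ^ 2) ≤ θ * ∑ p, ‖f p‖ ^ 2)
    (hθ0 : 0 ≤ θ) (hθ2 : 2 * θ < 1) :
    ∃ Y : Submodule ℂ V64, Y ≤ kerSpan ∧ 6 ≤ finrank ℂ Y ∧
      ∀ ℓ ∈ perpTo F, ∀ i v : Fin 2,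
        ‖Y.starProjection (rowVec (hComp i ℓ) v)‖ ^ 2 ≤ (2 * θ / (1 - 2 * θ)) * ‖ℓ‖ ^ 2 := by
  refine ⟨(zSub F).map kerProj, map_kerProj_le_kerSpan _, ?_, fun ℓ hℓ i v =>
    norm_sq_starProjection_rowVec_le hθ hθ0 hθ2 hℓ i v⟩
  rw [finrank_map_kerProj_zSub hθ hθ2]
  have h := finrank_zSub_ge F
  omega

/-- The bilinear-form space in plain coordinates, transported to `V16`. [folklore] -/
theorem finrank_map_toLp (F : Submodule ℂ (P2 × P2 → ℂ)) :
    finrank ℂ (F.map (WithLp.linearEquiv 2 ℂ (P2 × P2 → ℂ)).symm.toLinearMap) = finrank ℂ F :=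
  LinearEquiv.finrank_map_eq _ _

/-- `perpTo F` is the orthogonal complement of `F` transported to `V16`. [folklore] -/
theorem perpTo_eq_orthogonal (F : Submodule ℂ (P2 × P2 → ℂ)) :
    perpTo F = (F.map (WithLp.linearEquiv 2 ℂ (P2 × P2 → ℂ)).symm.toLinearMap)ᗮ := by
  ext ℓ
  rw [Submodule.mem_orthogonal]
  constructor
  · rintro hℓ f ⟨g, hg, rfl⟩
    rw [inner_eq_zero_symm]
    have h := hℓ g hg
    rw [PiLp.inner_apply]
    simpa [RCLike.inner_apply', mul_comm] using h
  · intro h g hg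
    have h1 := h _ ⟨g, hg, rfl⟩
    rw [inner_eq_zero_symm, PiLp.inner_apply] at h1
    simpa [RCLike.inner_apply', mul_comm] using h1

/-- `dim perpTo F = 16 − dim F`. [folklore] -/
theorem finrank_perpTo (F : Submodule ℂ (P2 × P2 → ℂ)) : finrank ℂ (perpTo F) + finrank ℂ F = 16 := by
  rw [perpTo_eq_orthogonal, add_comm, ← finrank_map_toLp F, Submodule.finrank_add_finrank_orthogonal,
    finrank_euclideanSpace]
  simp

/-- `annT` is the kernel of the slice-pairing map `V16 → (P2 → ℂ)`. [folklore] -/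
theorem annT_eq_ker : annT = LinearMap.ker
    ((LinearMap.pi fun c : P2 => (∑ p : P2 × P2, (T2 c p.1 p.2) •
      ((LinearMap.proj p : (P2 × P2 → ℂ) →ₗ[ℂ] ℂ).comp
        (WithLp.linearEquiv 2 ℂ (P2 × P2 → ℂ)).toLinearMap))) : V16 →ₗ[ℂ] (P2 → ℂ)) := by
  ext ℓ
  simp only [annT, Submodule.mem_mk, AddSubmonoid.mem_mk, AddSubsemigroup.mem_mk, Set.mem_setOf_eq,
    LinearMap.mem_ker, funext_iff, LinearMap.pi_apply, LinearMap.sum_apply, LinearMap.smul_apply,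
    LinearMap.comp_apply, LinearMap.proj_apply, Pi.zero_apply, smul_eq_mul]
  refine forall_congr' fun c => ?_
  rw [show (∑ p : P2 × P2, T2 c p.1 p.2 * (WithLp.linearEquiv 2 ℂ (P2 × P2 → ℂ)).toLinearMap ℓ p)
      = ∑ p : P2 × P2, ℓ p * T2 c p.1 p.2 from Finset.sum_congr rfl fun p _ => by rw [mul_comm]; rfl]

/-- The slice-pairing map is onto (each `e_c` is hit by half the slice `T_c`), so `dim annT = 12`.
[folklore] -/
theorem finrank_annT : finrank ℂ annT = 12 := by
  set Λ : V16 →ₗ[ℂ] (P2 → ℂ) := (LinearMap.pi fun c : P2 => (∑ p : P2 × P2, (T2 c p.1 p.2) •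
      ((LinearMap.proj p : (P2 × P2 → ℂ) →ₗ[ℂ] ℂ).comp
        (WithLp.linearEquiv 2 ℂ (P2 × P2 → ℂ)).toLinearMap))) with hΛ
  have hker : annT = LinearMap.ker Λ := annT_eq_ker
  have hΛapply : ∀ (ℓ : V16) (c : P2), Λ ℓ c = ∑ p : P2 × P2, ℓ p * T2 c p.1 p.2 := by
    intro ℓ c
    simp only [hΛ, LinearMap.pi_apply, LinearMap.sum_apply, LinearMap.smul_apply, LinearMap.comp_apply,
      LinearMap.proj_apply, smul_eq_mul]
    refine Finset.sum_congr rfl fun p _ => ?_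
    rw [mul_comm]; rfl
  -- surjectivity: `Λ (T_c / 2) = e_c`
  have hsurj : Function.Surjective Λ := by
    intro g
    refine ⟨WithLp.toLp 2 fun p => ∑ c, g c * T2 c p.1 p.2 / 2, ?_⟩
    funext c
    rw [hΛapply]
    simp only [T2_apply]
    obtain ⟨c1, c2⟩ := c
    fin_cases c1 <;> fin_cases c2 <;> simp [Fintype.sum_prod_type, Fin.sum_univ_two]
  have hrange : finrank ℂ (LinearMap.range Λ) = 4 := by
    rw [LinearMap.range_eq_top.2 hsurj, finrank_top]
    simp
  have h := LinearMap.finrank_range_add_finrank_ker Λ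
  rw [hrange, finrank_euclideanSpace] at h
  simp only [Fintype.card_prod, Fintype.card_fin] at h
  rw [hker]
  omega

/-- **The missing plane has dimension `≥ 2`** for a `10`-plane `F`:
`dim (annT ⊓ perpTo F) ≥ 12 + 6 − 16`. [folklore] -/
theorem two_le_finrank_missing {F : Submodule ℂ (P2 × P2 → ℂ)} (hF10 : finrank ℂ F = 10) :
    2 ≤ finrank ℂ (annT ⊓ perpTo F : Submodule ℂ V16) := by
  have h1 := Submodule.finrank_sup_add_finrank_inf_eq annT (perpTo F)
  have h2 : finrank ℂ (annT ⊔ perpTo F : Submodule ℂ V16) ≤ 16 := by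
    calc finrank ℂ (annT ⊔ perpTo F : Submodule ℂ V16) ≤ finrank ℂ V16 := Submodule.finrank_le _
      _ = 16 := by rw [finrank_euclideanSpace]; simp
  have h3 := finrank_perpTo F
  rw [finrank_annT] at h1
  omega

end Summit.MatrixMultiplication.MatrixMultiplication.Theorems.GapTwoSixExplicit

end
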